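import Literature.IUT.HodgeTheaters.PMBaseBridgeProps
import Literature.IUT.HodgeTheaters.PMBaseModelsProofs
import Literature.IUT.HodgeTheaters.LabelsPlusMinusTorsorsProofs

/-!
# Proof of [IUTchI] Proposition 6.6 (i): isomorphisms of `𝒟-Θ^±`-bridges form a `{±1} × {±1}^𝕍`-torsor

Mochizuki, *Inter-universal Teichmüller theory I*, §6, Proposition 6.6 (i) p. 165, kurims manuscript
(May 2020): "The set of isomorphisms between two `𝒟-Θ^±`-bridges forms a torsor over the group
`{±1} × ({±1}^𝕍)` — where the first (respectively, second) factor corresponds to poly-automorphisms of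
the sort described in Example 6.2, (ii) (respectively, Example 6.2, (iii)). Moreover, the first factor
may be thought of as corresponding to the induced isomorphisms of `𝔽_l^±`-groups between the index sets
of the capsules involved." Print: "follows immediately from the various definitions involved … together
with the explicit description of the various poly-automorphisms discussed in Examples 6.2, (ii), (iii)".

PROOF-ONLY companion (theorems, no definitions) to abc-iut-L5-t4's `PMBaseBridgeProps.lean`, by the L5
discharge seat abc-iut-L5-t13: the named statement `DThetaPMBridge.IsoTorsor B₁ B₂` is PROVED for every
pair of `𝒟-Θ^±`-bridges over every base kit (`DThetaPMBridge.isoTorsor`). Mechanism: every constituent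
poly-morphism `†φ^{Θ±}_t` of a `𝒟-Θ^±`-bridge is a `+`-full poly-isomorphism (it is conjugate to the
model's positive one, Example 6.2 (i)); an isomorphism of bridges is therefore the data of an isomorphism
of `𝔽_l^±`-groups `T ⥲ T'` (two of them: `κ`, `κ ∘ (−1)`), a class `ψ · Aut_+(‡𝔇_≻)` (a `{±1}^𝕍`-torsor,
`PMBaseModelsProofs`), and capsule classes FORCED by the compatibility condition.

Record only; [claim: Mochizuki2012, status: disputed]; nothing here takes a side on any disputed step.
-/

namespace Literature.IUT.HodgeTheaters

open CategoryTheory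

universe u

/-! ### Isomorphisms of `𝔽_l^±`-groups: `κ` or `κ ∘ (−1)` -/

namespace FlPMGroup

variable {l : ℕ} {E E' : Type*} (S : FlPMGroup l E) (S' : FlPMGroup l E')

/-- The negation of an `𝔽_l^±`-group read through any chart `e`: `neg = e⁻¹ ∘ (−) ∘ e`.
[claim: Mochizuki2012, status: disputed] -/
theorem neg_eq_conj {e : E ≃ ZMod l} (he : e ∈ S.charts) :
    S.neg = e.trans ((signPerm l (-1)).trans e.symm) := by
  ext t
  apply e.injective
  rw [S.chart_neg he]
  simp [Units.smul_def]

/-- Negation is an automorphism of the `𝔽_l^±`-group structure: charts pull back to charts.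
[claim: Mochizuki2012, status: disputed] -/
theorem neg_trans_mem {e : E ≃ ZMod l} (he : e ∈ S.charts) : S.neg.trans e ∈ S.charts := by
  have h : S.neg.trans e = e.trans (signPerm l (-1)) := by
    ext t
    simp [S.chart_neg he, Units.smul_def]
  rw [h]
  exact S.trans_signPerm_mem he (-1)

/-- **The isomorphisms of `𝔽_l^±`-groups `E ⥲ E'` are `κ` and `κ ∘ (−1)`** for any one of them, `κ`
([IUTchI] Prop 6.6 (i) p. 165: "the first factor [`{±1}`] may be thought of as corresponding to the
induced isomorphisms of `𝔽_l^±`-groups between the index sets"). [claim: Mochizuki2012, status: disputed] -/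
theorem compat_eq_or_eq_trans_neg {κ κ' : E ≃ E'} (hκ : ∀ e ∈ S'.charts, κ.trans e ∈ S.charts)
    (hκ' : ∀ e ∈ S'.charts, κ'.trans e ∈ S.charts) : κ' = κ ∨ κ' = κ.trans S'.neg := by
  obtain ⟨e, he⟩ := S'.nonempty
  obtain ⟨ε, hε⟩ := S.exists_sign_of_mem (hκ e he) (hκ' e he)
  have key : κ' = κ.trans (e.trans ((signPerm l ε).trans e.symm)) := by
    ext t
    have ht := congrArg (fun f : E ≃ ZMod l => e.symm (f t)) hε
    simpa using ht
  rcases Int.units_eq_one_or ε with rfl | rfl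
  · left
    rw [key]
    ext t
    simp
  · right
    rw [key, S'.neg_eq_conj he]

end FlPMGroup

namespace PMBaseKit

variable {l : ℕ} {K : PMBaseKit.{u} l}

namespace DThetaPMBridge

/-! ### Every `†φ^{Θ±}_t` is a `+`-full poly-isomorphism -/

/-- The constituent poly-morphisms `†φ^{Θ±}_t : †𝔇_t → †𝔇_≻` of a `𝒟-Θ^±`-bridge are `+`-full
poly-isomorphisms (conjugates of the model's positive `+`-full poly-isomorphisms, [IUTchI] Example 6.2 (i)
p. 160, Def 6.4 (i) p. 162). [claim: Mochizuki2012, status: disputed] -/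
theorem exists_poly_eq (B : K.DThetaPMBridge) :
    ∃ θ : ∀ t, (B.capsule t).Iso B.codomain, ∀ t, B.poly t = DStrip.plusFullPolyIso (θ t) := by
  obtain ⟨ι, -, α, β, h⟩ := B.exists_model
  have h' : ∀ t, ∃ θ : (B.capsule t).Iso B.codomain, B.poly t = DStrip.plusFullPolyIso θ := by
    intro t
    obtain ⟨z, rfl⟩ := ι.surjective t
    refine ⟨((α z).symm.trans (DStrip.Iso.refl _)).trans β, ?_⟩
    rw [h z, Ex62.poly_eq, DStrip.polyConj_plusFullPolyIso]
  choose θ hθ using h'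
  exact ⟨θ, hθ⟩

/-! ### Constructing isomorphisms of `𝒟-Θ^±`-bridges -/

/-- **Construction.** Any isomorphism of `𝔽_l^±`-groups `κ : T ⥲ T'` between the index sets and any
isomorphism `ψ : †𝔇_≻ ⥲ ‡𝔇_≻` determine an isomorphism of `𝒟-Θ^±`-bridges with index bijection `κ` and
`+`-full poly-isomorphism `ψ · Aut_+(‡𝔇_≻)` — its capsule constituents being forced by compatibility
([IUTchI] Def 6.4 (i) p. 162). [claim: Mochizuki2012, status: disputed] -/
theorem Iso.exists_of (B₁ B₂ : K.DThetaPMBridge) (κ : B₁.T ≃ B₂.T)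
    (hκ : ∀ e ∈ B₂.grpT.charts, κ.trans e ∈ B₁.grpT.charts) (ψ : B₁.codomain.Iso B₂.codomain) :
    ∃ g : Iso B₁ B₂, g.indexEquiv = κ ∧ g.codPoly = DStrip.plusFullPolyIso ψ := by
  obtain ⟨θ₁, hθ₁⟩ := B₁.exists_poly_eq
  obtain ⟨θ₂, hθ₂⟩ := B₂.exists_poly_eq
  refine ⟨{ indexEquiv := κ
            indexEquiv_charts := hκ
            capsPoly := fun t => DStrip.plusFullPolyIso ((θ₁ t).trans (ψ.trans (θ₂ (κ t)).symm))
            capsPoly_plusFull := fun t => ⟨_, rfl⟩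
            codPoly := DStrip.plusFullPolyIso ψ
            codPoly_plusFull := ⟨_, rfl⟩
            compat := fun t => ?_ }, rfl, rfl⟩
  rw [hθ₂ (κ t), hθ₁ t, DStrip.polyComp_plusFullPolyIso, DStrip.polyComp_plusFullPolyIso]
  congr 1
  funext v
  change ((θ₁ t v ≪≫ (ψ v ≪≫ (θ₂ (κ t) v).symm)) ≪≫ θ₂ (κ t) v) = θ₁ t v ≪≫ ψ v
  simp

/-- **Rigidity.** An isomorphism of `𝒟-Θ^±`-bridges is determined by its index bijection and its `+`-full
poly-isomorphism `†𝔇_≻ ⥲ ‡𝔇_≻`: the capsule constituents are forced by the compatibility with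
`†φ^{Θ±}_±`, `‡φ^{Θ±}_±` ([IUTchI] Def 6.4 (i) p. 162). [claim: Mochizuki2012, status: disputed] -/
theorem Iso.eq_of_indexEquiv_eq {B₁ B₂ : K.DThetaPMBridge} (g g' : Iso B₁ B₂)
    (h1 : g.indexEquiv = g'.indexEquiv) (h2 : g.codPoly = g'.codPoly) : g = g' := by
  obtain ⟨θ₁, hθ₁⟩ := B₁.exists_poly_eq
  obtain ⟨θ₂, hθ₂⟩ := B₂.exists_poly_eq
  rcases g with ⟨κ, hκ, cp, hcp, cod, hcod, hcompat⟩
  rcases g' with ⟨κ', hκ', cp', hcp', cod', hcod', hcompat'⟩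
  dsimp only at h1 h2
  subst h1
  subst h2
  obtain ⟨ψ, hψ⟩ := hcod
  have hcp_eq : cp = cp' := by
    funext t
    obtain ⟨φ, hφ⟩ := hcp t
    obtain ⟨φ', hφ'⟩ := hcp' t
    have hc := hcompat t
    have hc' := hcompat' t
    change DStrip.polyComp (cp t) (B₂.poly (κ t)) = DStrip.polyComp (B₁.poly t) cod at hc
    change DStrip.polyComp (cp' t) (B₂.poly (κ t)) = DStrip.polyComp (B₁.poly t) cod at hc'
    change cp t = DStrip.plusFullPolyIso φ at hφ
    change cp' t = DStrip.plusFullPolyIso φ' at hφ'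
    rw [hφ, hθ₂ (κ t), DStrip.polyComp_plusFullPolyIso] at hc
    rw [hφ', hθ₂ (κ t), DStrip.polyComp_plusFullPolyIso] at hc'
    rw [hφ, hφ']
    exact DStrip.plusFullPolyIso_trans_right_cancel (θ₂ (κ t)) (hc.trans hc'.symm)
  subst hcp_eq
  rfl

/-- The `+`-full poly-isomorphism `†𝔇_≻ ⥲ ‡𝔇_≻` of an isomorphism is spanned by one of its members.
[claim: Mochizuki2012, status: disputed] -/
theorem Iso.exists_codPoly_eq {B₁ B₂ : K.DThetaPMBridge} (g : Iso B₁ B₂) :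
    ∃ ψ : B₁.codomain.Iso B₂.codomain, g.codPoly = DStrip.plusFullPolyIso ψ :=
  g.codPoly_plusFull

/-! ### Proposition 6.6 (i) -/

/-- **[IUTchI] Proposition 6.6 (i) — DISCHARGED** over the base interface: for every pair of
`𝒟-Θ^±`-bridges the named statement `DThetaPMBridge.IsoTorsor` of `PMBaseBridgeProps.lean` holds —
isomorphisms exist; relative to any one of them, `f`, every `(s, α) ∈ {±1} × {±1}^𝕍` is realised by
exactly one isomorphism (index bijection `f`'s or `f`'s followed by `−1`; `+`-full poly-isomorphism
`†𝔇_≻ ⥲ ‡𝔇_≻` equal to `f`'s composed with `Aut^α(‡𝔇_≻)`), and every isomorphism so arises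
([IUTchI] Prop 6.6 (i) p. 165). [claim: Mochizuki2012, status: disputed] -/
theorem isoTorsor (B₁ B₂ : K.DThetaPMBridge) : IsoTorsor B₁ B₂ := by
  refine fun _ => ⟨?_, fun f => ⟨fun s α => ?_, fun g => ?_⟩⟩
  · -- existence of isomorphisms
    obtain ⟨κ, hκ⟩ := B₁.grpT.exists_isIso B₂.grpT
    obtain ⟨g, -, -⟩ := Iso.exists_of B₁ B₂ κ hκ
      (fun v => (B₁.codomain.isLocal v).some ≪≫ (B₂.codomain.isLocal v).some.symm)
    exact ⟨g⟩
  · -- each `(s, α)` is realised exactly once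
    obtain ⟨ψ, hψ⟩ := f.exists_codPoly_eq
    obtain ⟨a, ha⟩ := DStrip.exists_mem_signedPolyAut B₂.codomain α
    have hcod : DStrip.polyComp f.codPoly (B₂.codomain.signedPolyAut α) =
        DStrip.plusFullPolyIso (ψ.trans a) := by
      rw [hψ, DStrip.polyComp_plusFullPolyIso_signedPolyAut ψ ha]
    -- the index bijection prescribed by `s`
    have hκ' : ∀ e ∈ B₂.grpT.charts,
        (if s = 1 then f.indexEquiv else f.indexEquiv.trans B₂.grpT.neg).trans e ∈ B₁.grpT.charts := by
      intro e he
      split_ifs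
      · exact f.indexEquiv_charts e he
      · rw [Equiv.trans_assoc]
        exact f.indexEquiv_charts _ (B₂.grpT.neg_trans_mem he)
    obtain ⟨g, hg1, hg2⟩ := Iso.exists_of B₁ B₂ _ hκ' (ψ.trans a)
    refine ⟨g, ⟨hg1, hg2.trans hcod.symm⟩, fun g' hg' => ?_⟩
    exact Iso.eq_of_indexEquiv_eq g' g (hg'.1.trans hg1.symm) (hg'.2.trans (hcod.trans hg2.symm))
  · -- every isomorphism arises from `f` by some `(s, α)`
    obtain ⟨ψ, hψ⟩ := f.exists_codPoly_eq
    obtain ⟨ψ', hψ'⟩ := g.exists_codPoly_eq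
    obtain ⟨α, hα⟩ := DStrip.exists_signedPolyAut_polyComp_eq ψ ψ'
    rcases B₁.grpT.compat_eq_or_eq_trans_neg B₂.grpT f.indexEquiv_charts g.indexEquiv_charts with h | h
    · exact ⟨1, α, by rw [if_pos rfl, h], by rw [hψ, hψ', hα]⟩
    · exact ⟨-1, α, by rw [if_neg (by decide), h], by rw [hψ, hψ', hα]⟩

/-- `IsoTorsor` holds for all parameters — `_holds` alias of `isoTorsor` above under the fact's exact name
(appended 2026-08-28, D-0026 bookkeeping: the proof term is the existing theorem of this file; no statement,
definition or attribute is edited; no new named fact; the ledger's debt table listed the fact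
unproved). [claim: Mochizuki2012, status: disputed] -/
theorem _root_.Literature.IUT.HodgeTheaters.PMBaseKit.DThetaPMBridge.IsoTorsor_holds
    (B₁ B₂ : K.DThetaPMBridge) :
    IsoTorsor B₁ B₂ :=
  _root_.Literature.IUT.HodgeTheaters.PMBaseKit.DThetaPMBridge.isoTorsor B₁ B₂

end DThetaPMBridge

end PMBaseKit

end Literature.IUT.HodgeTheaters
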